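import Summits.QuantumFields.BalabanUV.T4Continuum.Support.NE7LyapunovTensor
import Summits.QuantumFields.BalabanUV.T4Continuum.Support.SmoothRefineInterp
import HarnessLib

/-!
# NE7LyapunovCellTable — THE FINE DIFFERENCES OF THE WHITNEY LIFT, CELL BY CELL: for `f = interp 2 (univ∖{κ}) φ` (block side `M = L = 2`) and every multi-order `α ∈ {0,1,2}⁴`,
# `(D^α f)(2y + ρ) = (T^{(κ)}_0(α₀,ρ₀) ⊛ T_1(α₁,ρ₁) ⊛ T_2(α₂,ρ₂) ⊛ T_3(α₃,ρ₃)) φ (y)` with the explicit one-direction stencil tables (forward differences; tent `ρ=0 ↦ (δ, ½∇, 0)`,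
# `ρ=1 ↦ (m, ½∇, lapI)`; flat `ρ=0 ↦ (δ, 0, ∇)`, `ρ=1 ↦ (δ, ∇, −∇)`) — the cell table of memo §12 (R3b)
# (lineage `b2b-balaban-t4-ne7b-p1`, gen 163; route (H′), memo `t4/b2b-balaban-t4-ne7b-p1/g162/records/SCOPING-LEVELMASSES.md` §11–§12, file (R3b), second part)

Cell `pub-balaban`, rung (B)+1 sub-cell t4, lineage `b2b-balaban-t4-ne7b-p1` (row NE7b OWNER + CRUX PROVER; junction service for row NE7 on ROAD-G116 §6 (G3) ∕ the ℓ² route to (G′)),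
generation 163.
WHY.  The composite letter (C) for the exact lift `r = W∘B_c⁻¹ − (gauge part)` (✓ `NE7WhitneyExactLiftFlat`) is proved through the `d = 4` Lyapunov form
`Q(u) = Σ_x Σ_{α∈{0,1,2}⁴} Π_μ c_{α_μ} ‖D^α u(x)‖²`, `c = (1, 1∕4, 5∕8)`, `D⁰ = 1`, `D¹_μ = ∇_μ`, `D²_μ = Δ_μ` (forward).  ✓ `NE7LyapunovTensor.lyapunov_tensor4_le` bounds the product form
`⊗_μ A^{(κ)}_μ` by `3(17∕8)³·⊗_μ B_μ`; what connects `A` to the lift is a CELL COMPUTATION: the fine differences of the multilinear interpolant `interp 2 S φ` (✓ `SmoothRefineInterp.interp`)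
at the fine site `2y + ρ`, `ρ ∈ {0,1}⁴`, are explicit one-direction coarse stencils in each direction, multiplied over the directions.  THIS FILE proves that table, uniformly in `α` and
`ρ`, by a one-direction STEP LEMMA (a forward fine difference in direction `μ` acts on a cell representation by `t ↦ (t(1) − t(0), τ_μ t(0) − t(1))`) and the closure of the two tables
under the step, then four applications (directions commute: ✓ `act_comm`).
WHAT ([folklore]; DATA defs: generic stencil constructors `shiftSt`, `negSt`, `sumSt`, `dStep`; named stencils `zero4`, `ngrad4`, `lap4`; the tables `tentCell`, `flatCell`, `cellT`, `Dst`; 0 sorry):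
§1 stencil algebra on any abelian group: `act_shiftSt`, `act_negSt`, `act_sumSt`, `act_dStep_zero∕one`, `act_zero4`, `act_ngrad4`, `act_lap4`, `act_lap4_eq_grad_grad`; the tables and their
   CLOSURE under the step: `tentCell_step01`, `tentCell_step12`, `flatCell_step01`, `flatCell_step12`; `act_tentCell_zero`, `act_flatCell_zero`;
§2 (every `d`) **`reprDir_step`**: if `F(2y+ρ) = act (t ρ_μ) (G ρ) y` with `G ρ` independent of `ρ_μ`, then `F(2y+ρ+e_μ) − F(2y+ρ) = act (dStep e_μ t ρ_μ) (G ρ) y`; `reprDir_table`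
   (`act (Dst e_μ a) F (2y+ρ) = act (T a ρ_μ) (G ρ) y` for every `a ∈ {0,1,2}` once `T` is step-closed); `interpCore_insert_lin` (one direction of `interpCore` = the two-point stencil, any weights);
§3 (`d = 4`) `pull2`, `pull3` (reordering nested actions), **`interp_cell_base`** (`interp 2 (univ∖{κ}) φ (2y+ρ)` = the nested action of `cellT κ μ 0 ρ_μ`), and the headline
   **`cell_table`**: `act (Dst e₀ α₀) (act (Dst e₁ α₁) (act (Dst e₂ α₂) (act (Dst e₃ α₃) (interp 2 (univ∖{κ}) φ)))) (2y+ρ) = act (cellT κ 0 α₀ ρ₀) (act (cellT κ 1 α₁ ρ₁) (act (cellT κ 2 α₂ ρ₂) (act (cellT κ 3 α₃ ρ₃) φ))) y`.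
WHAT IS NOT HERE: the summation over cells (the identification of the Lyapunov forms), the regrouping `cellT ≈ Aflat∕Atent`, the level iteration, the gauge part, (C) — next files.
HONEST FRAMING (page 1): elementary lattice algebra about OUR lift; nothing of Bałaban's asserted; NOT (C), NOT (G3), NOT (G′), NOT NE7∕NE3 as spine nodes; row NE7b NOT PRINTED ∕ NOT PROVED;
spine 0∕9; finite T⁴ rung (B)+1 — NOT infinite volume, NOT mass gap, NOT BetaPertH, NOT Clay.
-/

set_option autoImplicit false

open scoped BigOperators RealInnerProductSpace
open Finset

namespace Summit.QuantumFields.BalabanUV.T4Continuum.NE7LyapunovCellTable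

open Literature.MathematicalPhysics.QuantumFieldTheory.Balaban1983to89
open B7Prop1Explicit
open SmoothRefineBlocks (blk res blk_boxVec res_boxVec)
open SmoothRefineInterp (interp interpCore wt interpCore_insert interpCore_empty interpCore_add interpCore_smul interpCore_congr_weights)
open NE7StencilForms (act conv act_conv act_comm act_shift)
open NE7LyapunovTensor (delta4 grad4 mid4 hgrad4 lapI4 act_delta4 act_grad4 act_mid4 act_hgrad4_eq_mid_sub act_hgrad4_eq_sub_mid act_lapI4)

noncomputable section

variable {Γ : Type*} [AddCommGroup Γ]
variable {X : Type*} [NormedAddCommGroup X] [InnerProductSpace ℝ X]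

/-! ## §1 Stencil algebra: shift, negation, juxtaposition, the difference step; the tables -/

/-- Shift every translate of a stencil by `a`. [folklore] -/
def shiftSt {κ : Type*} (a : Γ) (s : κ → ℝ × Γ) : κ → ℝ × Γ := fun k => ((s k).1, (s k).2 + a)
/-- Negate every coefficient of a stencil. [folklore] -/
def negSt {κ : Type*} (s : κ → ℝ × Γ) : κ → ℝ × Γ := fun k => (-(s k).1, (s k).2)
/-- Juxtaposition of two stencils (index `κ ⊕ κ'`): the sum of their actions. [folklore] -/
def sumSt {κ κ' : Type*} (s : κ → ℝ × Γ) (t : κ' → ℝ × Γ) : κ ⊕ κ' → ℝ × Γ := Sum.elim s t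
/-- **THE DIFFERENCE STEP** on a two-residue family `t`: `dStep a t 0 = t 1 − t 0`, `dStep a t 1 = τ_a t 0 − t 1`. [folklore] -/
def dStep {κ : Type*} (a : Γ) (t : Fin 2 → (κ → ℝ × Γ)) : Fin 2 → (κ ⊕ κ → ℝ × Γ) :=
  ![sumSt (t 1) (negSt (t 0)), sumSt (shiftSt a (t 0)) (negSt (t 1))]

/-- The zero stencil (padded to four entries). [folklore] -/
def zero4 (a : Γ) : Fin 4 → ℝ × Γ := ![((0 : ℝ), (0 : Γ)), (0, a), (0, a), (0, a)]
/-- `−∇_a`. [folklore] -/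
def ngrad4 (a : Γ) : Fin 4 → ℝ × Γ := ![((1 : ℝ), (0 : Γ)), (-1, a), (0, a), (0, a)]
/-- `Δ_a` (forward second difference `v(y+2a) − 2v(y+a) + v(y)`). [folklore] -/
def lap4 (a : Γ) : Fin 4 → ℝ × Γ := ![((1 : ℝ), (0 : Γ)), (-2, a), (1, a + a), (0, a)]

/-- **THE TENT TABLE** (transverse directions): `a`-th difference at residue `r`: `(δ, m; ½∇, ½∇; 0, lapI)`. [folklore] -/
def tentCell (a : Γ) : Fin 3 → Fin 2 → (Fin 4 → ℝ × Γ) := ![![delta4 a, mid4 a], ![hgrad4 a, hgrad4 a], ![zero4 a, lapI4 a]]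
/-- **THE FLAT TABLE** (longitudinal direction): `(δ, δ; 0, ∇; ∇, −∇)`. [folklore] -/
def flatCell (a : Γ) : Fin 3 → Fin 2 → (Fin 4 → ℝ × Γ) := ![![delta4 a, delta4 a], ![zero4 a, grad4 a], ![grad4 a, ngrad4 a]]
/-- The fine difference stencils `D⁰ = δ`, `D¹ = ∇`, `D² = Δ`. [folklore] -/
def Dst (a : Γ) : Fin 3 → (Fin 4 → ℝ × Γ) := ![delta4 a, grad4 a, lap4 a]

section StencilAlgebra

variable {κ κ' : Type*} [Fintype κ] [Fintype κ']

/-- `act (shiftSt a s) v y = act s v (y + a)`. [folklore] -/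
theorem act_shiftSt (a : Γ) (s : κ → ℝ × Γ) (v : Γ → X) (y : Γ) : act (shiftSt a s) v y = act s v (y + a) := by
  simp only [act, shiftSt, add_right_comm y a, ← add_assoc]
/-- `act (negSt s) v y = −act s v y`. [folklore] -/
theorem act_negSt (s : κ → ℝ × Γ) (v : Γ → X) (y : Γ) : act (negSt s) v y = -act s v y := by
  simp only [act, negSt, neg_smul, Finset.sum_neg_distrib]
/-- `act (sumSt s t) v y = act s v y + act t v y`. [folklore] -/
theorem act_sumSt (s : κ → ℝ × Γ) (t : κ' → ℝ × Γ) (v : Γ → X) (y : Γ) : act (sumSt s t) v y = act s v y + act t v y := by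
  simp only [act, sumSt, Fintype.sum_sum_type, Sum.elim_inl, Sum.elim_inr]
/-- `act (dStep a t 0) v y = act (t 1) v y − act (t 0) v y`. [folklore] -/
theorem act_dStep_zero (a : Γ) (t : Fin 2 → (κ → ℝ × Γ)) (v : Γ → X) (y : Γ) : act (dStep a t 0) v y = act (t 1) v y - act (t 0) v y := by
  rw [show dStep a t 0 = sumSt (t 1) (negSt (t 0)) from rfl, act_sumSt, act_negSt, sub_eq_add_neg]
/-- `act (dStep a t 1) v y = act (t 0) v (y + a) − act (t 1) v y`. [folklore] -/
theorem act_dStep_one (a : Γ) (t : Fin 2 → (κ → ℝ × Γ)) (v : Γ → X) (y : Γ) : act (dStep a t 1) v y = act (t 0) v (y + a) - act (t 1) v y := by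
  rw [show dStep a t 1 = sumSt (shiftSt a (t 0)) (negSt (t 1)) from rfl, act_sumSt, act_shiftSt, act_negSt, sub_eq_add_neg]

variable (a : Γ) (v : Γ → X) (y : Γ)

/-- The zero stencil acts by zero. [folklore] -/
theorem act_zero4 : act (zero4 a) v y = 0 := by
  simp [act, zero4, Fin.sum_univ_four]
/-- `act (ngrad4 a) v y = v y − v (y + a)`. [folklore] -/
theorem act_ngrad4 : act (ngrad4 a) v y = v y - v (y + a) := by
  simp [act, ngrad4, Fin.sum_univ_four]; abel
/-- `act (lap4 a) v y = v (y + a + a) − 2 • v (y + a) + v y`. [folklore] -/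
theorem act_lap4 : act (lap4 a) v y = v (y + a + a) - (2 : ℝ) • v (y + a) + v y := by
  simp [act, lap4, Fin.sum_univ_four, add_assoc]; module
/-- `Δ = ∇∘∇`: `act (lap4 a) v y = act (grad4 a) (act (grad4 a) v) y`. [folklore] -/
theorem act_lap4_eq_grad_grad : act (lap4 a) v y = act (grad4 a) (act (grad4 a) v) y := by
  rw [act_lap4, act_grad4, act_grad4, act_grad4]; module

/-- The tent table at order `0`: `act (tentCell a 0 r) v y = (1 − r∕2) • v y + (r∕2) • v (y + a)`. [folklore] -/
theorem act_tentCell_zero (r : Fin 2) : act (tentCell a 0 r) v y = (1 - ((r : ℕ) : ℝ) / 2) • v y + (((r : ℕ) : ℝ) / 2) • v (y + a) := by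
  fin_cases r
  · simp [tentCell, act_delta4]
  · simp [tentCell, act_mid4]; norm_num
/-- The flat table at order `0` is the identity at both residues. [folklore] -/
theorem act_flatCell_zero (r : Fin 2) : act (flatCell a 0 r) v y = v y := by
  fin_cases r <;> simp [flatCell, act_delta4]

/-- **CLOSURE OF THE TENT TABLE, order 0 → 1**: `dStep a (tentCell a 0) r ≡ tentCell a 1 r` (`m − δ = ½∇`, `τδ − m = ½∇`). [folklore] -/
theorem tentCell_step01 (r : Fin 2) : act (dStep a (tentCell a 0) r) v y = act (tentCell a 1 r) v y := by
  fin_cases r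
  · simp only [Fin.zero_eta, act_dStep_zero, tentCell, Matrix.cons_val_zero, Matrix.cons_val_one, act_hgrad4_eq_mid_sub, act_delta4]
  · simp only [Fin.mk_one, act_dStep_one, tentCell, Matrix.cons_val_zero, Matrix.cons_val_one, act_hgrad4_eq_sub_mid, act_delta4]
/-- **CLOSURE OF THE TENT TABLE, order 1 → 2**: `dStep a (tentCell a 1) r ≡ tentCell a 2 r` (`½∇ − ½∇ = 0`, `τ½∇ − ½∇ = lapI`). [folklore] -/
theorem tentCell_step12 (r : Fin 2) : act (dStep a (tentCell a 1) r) v y = act (tentCell a 2 r) v y := by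
  fin_cases r
  · simp only [Fin.zero_eta, act_dStep_zero, tentCell, Matrix.cons_val_zero, Matrix.cons_val_one, Matrix.cons_val_two, Matrix.head_cons, Matrix.tail_cons, act_zero4, sub_self]
  · simp only [Fin.mk_one, act_dStep_one, tentCell, Matrix.cons_val_zero, Matrix.cons_val_one, Matrix.cons_val_two, Matrix.head_cons, Matrix.tail_cons, act_lapI4,
      act_hgrad4_eq_sub_mid, act_mid4]
    module
/-- **CLOSURE OF THE FLAT TABLE, order 0 → 1**: `(δ − δ, τδ − δ) = (0, ∇)`. [folklore] -/
theorem flatCell_step01 (r : Fin 2) : act (dStep a (flatCell a 0) r) v y = act (flatCell a 1 r) v y := by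
  fin_cases r
  · simp only [Fin.zero_eta, act_dStep_zero, flatCell, Matrix.cons_val_zero, Matrix.cons_val_one, act_delta4, act_zero4, sub_self]
  · simp only [Fin.mk_one, act_dStep_one, flatCell, Matrix.cons_val_zero, Matrix.cons_val_one, act_delta4, act_grad4]
/-- **CLOSURE OF THE FLAT TABLE, order 1 → 2**: `(∇ − 0, τ0 − ∇) = (∇, −∇)`. [folklore] -/
theorem flatCell_step12 (r : Fin 2) : act (dStep a (flatCell a 1) r) v y = act (flatCell a 2 r) v y := by
  fin_cases r
  · simp only [Fin.zero_eta, act_dStep_zero, flatCell, Matrix.cons_val_zero, Matrix.cons_val_one, Matrix.cons_val_two, Matrix.head_cons, Matrix.tail_cons, act_zero4, sub_zero]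
  · simp only [Fin.mk_one, act_dStep_one, flatCell, Matrix.cons_val_zero, Matrix.cons_val_one, Matrix.cons_val_two, Matrix.head_cons, Matrix.tail_cons, act_zero4, act_grad4,
      act_ngrad4, zero_sub, neg_sub]

end StencilAlgebra

/-! ## §2 The one-direction step on the refined lattice (`M = 2`, every `d`) -/

section Step

variable {d : ℕ}

/-- Raising the `μ`-residue from `0` to `1`: `boxVec 2 ρ + e_μ = boxVec 2 (ρ[μ ↦ 1])` when `ρ_μ = 0`. [folklore] -/
theorem boxVec_add_e_of_zero {ρ : Fin d → Fin 2} {μ : Fin d} (h : ρ μ = 0) :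
    boxVec (d := d) 2 ρ + e μ = boxVec 2 (Function.update ρ μ 1) := by
  funext i
  by_cases hi : i = μ
  · subst hi; simp [boxVec, h, e_apply]
  · simp [boxVec, e_apply, hi]

/-- Carrying: `2•y + boxVec 2 ρ + e_μ = 2•(y + e_μ) + boxVec 2 (ρ[μ ↦ 0])` when `ρ_μ = 1`. [folklore] -/
theorem boxVec_add_e_of_one {ρ : Fin d → Fin 2} {μ : Fin d} (h : ρ μ = 1) (y : Site d) :
    (2 : ℤ) • y + boxVec (d := d) 2 ρ + e μ = (2 : ℤ) • (y + e μ) + boxVec 2 (Function.update ρ μ 0) := by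
  funext i
  by_cases hi : i = μ
  · subst hi; simp [boxVec, h, e_apply]; ring
  · simp [boxVec, e_apply, hi]

/-- **THE STEP LEMMA**: if on every cell `F(2y+ρ) = act (t ρ_μ) (G ρ) y` with `G ρ` independent of `ρ_μ`, then the forward fine difference in direction `μ` is represented by `dStep e_μ t`:
`F(2y+ρ+e_μ) − F(2y+ρ) = act (dStep e_μ t ρ_μ) (G ρ) y`. [folklore] -/
theorem reprDir_step {k : Type*} [Fintype k] (μ : Fin d) {F : Site d → X} (t : Fin 2 → (k → ℝ × Site d)) (G : (Fin d → Fin 2) → Site d → X)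
    (hG : ∀ ρ ρ' : Fin d → Fin 2, (∀ ν, ν ≠ μ → ρ ν = ρ' ν) → G ρ = G ρ')
    (hF : ∀ (ρ : Fin d → Fin 2) (y : Site d), F ((2 : ℤ) • y + boxVec 2 ρ) = act (t (ρ μ)) (G ρ) y)
    (ρ : Fin d → Fin 2) (y : Site d) :
    F ((2 : ℤ) • y + boxVec 2 ρ + e μ) - F ((2 : ℤ) • y + boxVec 2 ρ) = act (dStep (e μ) t (ρ μ)) (G ρ) y := by
  obtain h | h : ρ μ = 0 ∨ ρ μ = 1 := by
    have h2 := (ρ μ).isLt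
    have h3 : (ρ μ).val = 0 ∨ (ρ μ).val = 1 := by omega
    exact h3.imp (fun h => Fin.ext h) (fun h => Fin.ext h)
  · -- residue 0 → 1 inside the cell
    have hG' : G (Function.update ρ μ 1) = G ρ := hG _ _ fun ν hν => Function.update_of_ne hν _ _
    rw [add_assoc, boxVec_add_e_of_zero h, hF, hF, h, act_dStep_zero, Function.update_self, hG']
  · -- residue 1 → 0 of the next cell
    have hG' : G (Function.update ρ μ 0) = G ρ := hG _ _ fun ν hν => Function.update_of_ne hν _ _
    rw [boxVec_add_e_of_one h y, hF, hF, h, act_dStep_one, Function.update_self, hG']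

/-- The step lemma for the stencil `∇_μ = grad4 e_μ`. [folklore] -/
theorem reprDir_grad {k : Type*} [Fintype k] (μ : Fin d) {F : Site d → X} (t : Fin 2 → (k → ℝ × Site d)) (G : (Fin d → Fin 2) → Site d → X)
    (hG : ∀ ρ ρ' : Fin d → Fin 2, (∀ ν, ν ≠ μ → ρ ν = ρ' ν) → G ρ = G ρ')
    (hF : ∀ (ρ : Fin d → Fin 2) (y : Site d), F ((2 : ℤ) • y + boxVec 2 ρ) = act (t (ρ μ)) (G ρ) y)
    (ρ : Fin d → Fin 2) (y : Site d) :
    act (grad4 (e μ)) F ((2 : ℤ) • y + boxVec 2 ρ) = act (dStep (e μ) t (ρ μ)) (G ρ) y := by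
  rw [act_grad4]
  exact reprDir_step μ t G hG hF ρ y

/-- **A STEP-CLOSED TABLE REPRESENTS ALL THREE DIFFERENCES**: if `T 0` represents `F` in direction `μ` and `dStep e_μ (T 0) ≡ T 1`, `dStep e_μ (T 1) ≡ T 2`, then
`act (Dst e_μ a) F (2y+ρ) = act (T a ρ_μ) (G ρ) y` for `a = 0, 1, 2`. [folklore] -/
theorem reprDir_table (μ : Fin d) (T : Fin 3 → Fin 2 → (Fin 4 → ℝ × Site d))
    (h01 : ∀ (r : Fin 2) (v : Site d → X) (y : Site d), act (dStep (e μ) (T 0) r) v y = act (T 1 r) v y)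
    (h12 : ∀ (r : Fin 2) (v : Site d → X) (y : Site d), act (dStep (e μ) (T 1) r) v y = act (T 2 r) v y)
    {F : Site d → X} (G : (Fin d → Fin 2) → Site d → X) (hG : ∀ ρ ρ' : Fin d → Fin 2, (∀ ν, ν ≠ μ → ρ ν = ρ' ν) → G ρ = G ρ')
    (hF : ∀ (ρ : Fin d → Fin 2) (y : Site d), F ((2 : ℤ) • y + boxVec 2 ρ) = act (T 0 (ρ μ)) (G ρ) y)
    (a : Fin 3) (ρ : Fin d → Fin 2) (y : Site d) :
    act (Dst (e μ) a) F ((2 : ℤ) • y + boxVec 2 ρ) = act (T a (ρ μ)) (G ρ) y := by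
  have h1 : ∀ (ρ : Fin d → Fin 2) (y : Site d), act (grad4 (e μ)) F ((2 : ℤ) • y + boxVec 2 ρ) = act (T 1 (ρ μ)) (G ρ) y := fun ρ y => by
    rw [reprDir_grad μ (T 0) G hG hF, h01]
  fin_cases a
  · simp only [Dst, Fin.zero_eta, Matrix.cons_val_zero, act_delta4]; exact hF ρ y
  · simp only [Dst, Fin.mk_one, Matrix.cons_val_one]; exact h1 ρ y
  · simp only [Dst, Fin.reduceFinMk, Matrix.cons_val_two, Matrix.tail_cons, Matrix.head_cons]
    rw [act_lap4_eq_grad_grad, reprDir_grad μ (T 1) G hG h1, h12]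

/-- One direction of `interpCore` with ARBITRARY weights is the two-point stencil applied inside: `interpCore (insert i S) G z w = interpCore S ((1−w_i)•G + w_i•G(·+e_i)) z w` (`i ∉ S`). [folklore] -/
theorem interpCore_insert_lin {Y : Type*} [AddCommGroup Y] [Module ℝ Y] {S : Finset (Fin d)} {i : Fin d} (hi : i ∉ S) (G : Site d → Y) (z : Site d) (w : Fin d → ℝ) :
    interpCore (insert i S) G z w = interpCore S (fun x => (1 - w i) • G x + w i • G (x + e i)) z w := by
  rw [interpCore_insert hi, interpCore_add, interpCore_smul, interpCore_smul]

end Step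

/-! ## §3 `d = 4`: reordering nested actions, the base representation of the interpolant, and the cell table -/

section Four

/-- **THE CELL TABLE OF THE LIFT**: flat table in the longitudinal direction `κ`, tent table in the transverse ones. [folklore] -/
def cellT (κ μ : Fin 4) : Fin 3 → Fin 2 → (Fin 4 → ℝ × Site 4) := if μ = κ then flatCell (e μ) else tentCell (e μ)

/-- The cell table is step-closed, order 0 → 1. [folklore] -/
theorem cellT_step01 (κ μ : Fin 4) (r : Fin 2) (v : Site 4 → X) (y : Site 4) : act (dStep (e μ) (cellT κ μ 0) r) v y = act (cellT κ μ 1 r) v y := by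
  unfold cellT; split_ifs
  · exact flatCell_step01 _ v y r
  · exact tentCell_step01 _ v y r
/-- The cell table is step-closed, order 1 → 2. [folklore] -/
theorem cellT_step12 (κ μ : Fin 4) (r : Fin 2) (v : Site 4 → X) (y : Site 4) : act (dStep (e μ) (cellT κ μ 1) r) v y = act (cellT κ μ 2 r) v y := by
  unfold cellT; split_ifs
  · exact flatCell_step12 _ v y r
  · exact tentCell_step12 _ v y r
/-- The cell table at order 0 in the longitudinal direction is the identity. [folklore] -/
theorem act_cellT_zero_self (κ : Fin 4) (r : Fin 2) (v : Site 4 → X) (y : Site 4) : act (cellT κ κ 0 r) v y = v y := by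
  simp only [cellT, if_true, act_flatCell_zero]
/-- The cell table at order 0 in a transverse direction `μ ≠ κ` is the two-point stencil with weights `(1 − r∕2, r∕2)`. [folklore] -/
theorem act_cellT_zero_ne {κ μ : Fin 4} (h : μ ≠ κ) (r : Fin 2) (v : Site 4 → X) (x : Site 4) :
    act (cellT κ μ 0 r) v x = (1 - ((r : ℕ) : ℝ) / 2) • v x + (((r : ℕ) : ℝ) / 2) • v (x + e μ) := by
  simp only [cellT, h, if_false, act_tentCell_zero]

variable {k₀ k₁ k₂ k₃ : Type*} [Fintype k₀] [Fintype k₁] [Fintype k₂] [Fintype k₃]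

omit [Fintype k₃] in
/-- Pull the third factor of a nested action to the front. [folklore] -/
theorem pull2 (s₀ : k₀ → ℝ × Γ) (s₁ : k₁ → ℝ × Γ) (s₂ : k₂ → ℝ × Γ) (H : Γ → X) : act s₀ (act s₁ (act s₂ H)) = act s₂ (act s₀ (act s₁ H)) := by
  rw [act_comm s₁ s₂, act_comm s₀ s₂]
/-- Pull the fourth factor of a nested action to the front. [folklore] -/
theorem pull3 (s₀ : k₀ → ℝ × Γ) (s₁ : k₁ → ℝ × Γ) (s₂ : k₂ → ℝ × Γ) (s₃ : k₃ → ℝ × Γ) (H : Γ → X) :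
    act s₀ (act s₁ (act s₂ (act s₃ H))) = act s₃ (act s₀ (act s₁ (act s₂ H))) := by
  rw [act_comm s₂ s₃, act_comm s₁ s₃, act_comm s₀ s₃]

/-- The interpolation weights at the fine site `2y + ρ` are `ρ∕2`. [folklore] -/
theorem wt_cell {d : ℕ} (y : Site d) (ρ : Fin d → Fin 2) : wt 2 ((2 : ℤ) • y + boxVec 2 ρ) = fun i => ((ρ i : ℕ) : ℝ) / 2 := by
  funext i
  have h := res_boxVec (d := d) (L := 2) (by norm_num) y ρ
  simp only [Nat.cast_ofNat] at h
  simp only [wt, h, boxVec, Nat.cast_ofNat, Int.cast_natCast]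

/-- **THE BASE REPRESENTATION**: at the fine site `2y + ρ` the transverse multilinear interpolant is the nested action of the order-0 cell stencils:
`interp 2 (univ∖{κ}) φ (2y+ρ) = act (cellT κ 0 0 ρ₀) (act (cellT κ 1 0 ρ₁) (act (cellT κ 2 0 ρ₂) (act (cellT κ 3 0 ρ₃) φ))) y`. [folklore] -/
theorem interp_cell_base (κ : Fin 4) (φ : Site 4 → X) (ρ : Fin 4 → Fin 2) (y : Site 4) :
    interp 2 (Finset.univ.erase κ) φ ((2 : ℤ) • y + boxVec 2 ρ)
      = act (cellT κ 0 0 (ρ 0)) (act (cellT κ 1 0 (ρ 1)) (act (cellT κ 2 0 (ρ 2)) (act (cellT κ 3 0 (ρ 3)) φ))) y := by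
  unfold interp
  have hb := blk_boxVec (d := 4) (L := 2) (by norm_num) y ρ
  simp only [Nat.cast_ofNat] at hb
  rw [hb, wt_cell]
  obtain rfl | rfl | rfl | rfl : κ = 0 ∨ κ = 1 ∨ κ = 2 ∨ κ = 3 := by fin_cases κ <;> simp
  · have hS : (Finset.univ : Finset (Fin 4)).erase 0 = insert 3 (insert 2 (insert 1 ∅)) := by decide
    rw [hS, interpCore_insert_lin (by decide), interpCore_insert_lin (by decide), interpCore_insert_lin (by decide), interpCore_empty]
    simp only [act_cellT_zero_self, act_cellT_zero_ne (show (1 : Fin 4) ≠ 0 by decide), act_cellT_zero_ne (show (2 : Fin 4) ≠ 0 by decide),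
      act_cellT_zero_ne (show (3 : Fin 4) ≠ 0 by decide)]
  · have hS : (Finset.univ : Finset (Fin 4)).erase 1 = insert 3 (insert 2 (insert 0 ∅)) := by decide
    rw [hS, interpCore_insert_lin (by decide), interpCore_insert_lin (by decide), interpCore_insert_lin (by decide), interpCore_empty]
    simp only [act_cellT_zero_self, act_cellT_zero_ne (show (0 : Fin 4) ≠ 1 by decide), act_cellT_zero_ne (show (2 : Fin 4) ≠ 1 by decide),
      act_cellT_zero_ne (show (3 : Fin 4) ≠ 1 by decide)]
  · have hS : (Finset.univ : Finset (Fin 4)).erase 2 = insert 3 (insert 1 (insert 0 ∅)) := by decide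
    rw [hS, interpCore_insert_lin (by decide), interpCore_insert_lin (by decide), interpCore_insert_lin (by decide), interpCore_empty]
    simp only [act_cellT_zero_self, act_cellT_zero_ne (show (0 : Fin 4) ≠ 2 by decide), act_cellT_zero_ne (show (1 : Fin 4) ≠ 2 by decide),
      act_cellT_zero_ne (show (3 : Fin 4) ≠ 2 by decide)]
  · have hS : (Finset.univ : Finset (Fin 4)).erase 3 = insert 2 (insert 1 (insert 0 ∅)) := by decide
    rw [hS, interpCore_insert_lin (by decide), interpCore_insert_lin (by decide), interpCore_insert_lin (by decide), interpCore_empty]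
    simp only [act_cellT_zero_self, act_cellT_zero_ne (show (0 : Fin 4) ≠ 3 by decide), act_cellT_zero_ne (show (1 : Fin 4) ≠ 3 by decide),
      act_cellT_zero_ne (show (2 : Fin 4) ≠ 3 by decide)]

/-- **THE CELL TABLE** (`d = 4`, `M = 2`): for every longitudinal direction `κ`, multi-order `α`, cell `y` and corner `ρ`,
`act (Dst e₀ α₀) (act (Dst e₁ α₁) (act (Dst e₂ α₂) (act (Dst e₃ α₃) (interp 2 (univ∖{κ}) φ)))) (2y+ρ) = act (cellT κ 0 α₀ ρ₀) (act (cellT κ 1 α₁ ρ₁) (act (cellT κ 2 α₂ ρ₂) (act (cellT κ 3 α₃ ρ₃) φ))) y`.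
[folklore] -/
theorem cell_table (κ : Fin 4) (φ : Site 4 → X) (α : Fin 4 → Fin 3) (ρ : Fin 4 → Fin 2) (y : Site 4) :
    act (Dst (e 0) (α 0)) (act (Dst (e 1) (α 1)) (act (Dst (e 2) (α 2)) (act (Dst (e 3) (α 3)) (interp 2 (Finset.univ.erase κ) φ)))) ((2 : ℤ) • y + boxVec 2 ρ)
      = act (cellT κ 0 (α 0) (ρ 0)) (act (cellT κ 1 (α 1) (ρ 1)) (act (cellT κ 2 (α 2) (ρ 2)) (act (cellT κ 3 (α 3) (ρ 3)) φ))) y := by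
  set F₀ : Site 4 → X := interp 2 (Finset.univ.erase κ) φ with hF₀
  set F₁ : Site 4 → X := act (Dst (e 3) (α 3)) F₀ with hF₁
  set F₂ : Site 4 → X := act (Dst (e 2) (α 2)) F₁ with hF₂
  set F₃ : Site 4 → X := act (Dst (e 1) (α 1)) F₂ with hF₃
  -- direction 3 (innermost difference): the base, with the fourth factor pulled to the front
  have h0 : ∀ (ρ : Fin 4 → Fin 2) (y : Site 4), F₀ ((2 : ℤ) • y + boxVec 2 ρ)
      = act (cellT κ 3 0 (ρ 3)) (act (cellT κ 0 0 (ρ 0)) (act (cellT κ 1 0 (ρ 1)) (act (cellT κ 2 0 (ρ 2)) φ))) y := by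
    intro ρ y; rw [hF₀, interp_cell_base, pull3]
  have h1 : ∀ (ρ : Fin 4 → Fin 2) (y : Site 4), F₁ ((2 : ℤ) • y + boxVec 2 ρ)
      = act (cellT κ 0 0 (ρ 0)) (act (cellT κ 1 0 (ρ 1)) (act (cellT κ 2 0 (ρ 2)) (act (cellT κ 3 (α 3) (ρ 3)) φ))) y := by
    intro ρ y
    rw [pull3, hF₁]
    exact reprDir_table 3 (cellT κ 3) (cellT_step01 κ 3) (cellT_step12 κ 3)
      (fun ρ => act (cellT κ 0 0 (ρ 0)) (act (cellT κ 1 0 (ρ 1)) (act (cellT κ 2 0 (ρ 2)) φ)))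
      (fun ρ ρ' h => by simp only [h 0 (by decide), h 1 (by decide), h 2 (by decide)]) h0 (α 3) ρ y
  -- direction 2
  have h1' : ∀ (ρ : Fin 4 → Fin 2) (y : Site 4), F₁ ((2 : ℤ) • y + boxVec 2 ρ)
      = act (cellT κ 2 0 (ρ 2)) (act (cellT κ 0 0 (ρ 0)) (act (cellT κ 1 0 (ρ 1)) (act (cellT κ 3 (α 3) (ρ 3)) φ))) y := by
    intro ρ y; rw [h1, pull2]
  have h2 : ∀ (ρ : Fin 4 → Fin 2) (y : Site 4), F₂ ((2 : ℤ) • y + boxVec 2 ρ)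
      = act (cellT κ 0 0 (ρ 0)) (act (cellT κ 1 0 (ρ 1)) (act (cellT κ 2 (α 2) (ρ 2)) (act (cellT κ 3 (α 3) (ρ 3)) φ))) y := by
    intro ρ y
    rw [pull2, hF₂]
    exact reprDir_table 2 (cellT κ 2) (cellT_step01 κ 2) (cellT_step12 κ 2)
      (fun ρ => act (cellT κ 0 0 (ρ 0)) (act (cellT κ 1 0 (ρ 1)) (act (cellT κ 3 (α 3) (ρ 3)) φ)))
      (fun ρ ρ' h => by simp only [h 0 (by decide), h 1 (by decide), h 3 (by decide)]) h1' (α 2) ρ y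
  -- direction 1
  have h2' : ∀ (ρ : Fin 4 → Fin 2) (y : Site 4), F₂ ((2 : ℤ) • y + boxVec 2 ρ)
      = act (cellT κ 1 0 (ρ 1)) (act (cellT κ 0 0 (ρ 0)) (act (cellT κ 2 (α 2) (ρ 2)) (act (cellT κ 3 (α 3) (ρ 3)) φ))) y := by
    intro ρ y; rw [h2, act_comm (cellT κ 0 0 (ρ 0)) (cellT κ 1 0 (ρ 1))]
  have h3 : ∀ (ρ : Fin 4 → Fin 2) (y : Site 4), F₃ ((2 : ℤ) • y + boxVec 2 ρ)
      = act (cellT κ 0 0 (ρ 0)) (act (cellT κ 1 (α 1) (ρ 1)) (act (cellT κ 2 (α 2) (ρ 2)) (act (cellT κ 3 (α 3) (ρ 3)) φ))) y := by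
    intro ρ y
    rw [act_comm (cellT κ 0 0 (ρ 0)) (cellT κ 1 (α 1) (ρ 1)), hF₃]
    exact reprDir_table 1 (cellT κ 1) (cellT_step01 κ 1) (cellT_step12 κ 1)
      (fun ρ => act (cellT κ 0 0 (ρ 0)) (act (cellT κ 2 (α 2) (ρ 2)) (act (cellT κ 3 (α 3) (ρ 3)) φ)))
      (fun ρ ρ' h => by simp only [h 0 (by decide), h 2 (by decide), h 3 (by decide)]) h2' (α 1) ρ y
  -- direction 0 (outermost)
  exact reprDir_table 0 (cellT κ 0) (cellT_step01 κ 0) (cellT_step12 κ 0)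
    (fun ρ => act (cellT κ 1 (α 1) (ρ 1)) (act (cellT κ 2 (α 2) (ρ 2)) (act (cellT κ 3 (α 3) (ρ 3)) φ)))
    (fun ρ ρ' h => by simp only [h 1 (by decide), h 2 (by decide), h 3 (by decide)]) h3 (α 0) ρ y

end Four

end

end Summit.QuantumFields.BalabanUV.T4Continuum.NE7LyapunovCellTable
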